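import Summits.RiemannHypothesis.RiemannHypothesis.Theses.SpectralTrace
import Summits.RiemannHypothesis.RiemannHypothesis.Theorems.WindowStep.Negative.FiniteMoves
import Summits.RiemannHypothesis.RiemannHypothesis.Theorems.WindowStep.Negative.ExpSumUniqueness
import Summits.RiemannHypothesis.RiemannHypothesis.Theorems.WindowTraceArch.Negative.LocalWeylTools
import Literature.NumberTheory.LFunctions.WeilMellinBounds
import Literature.NumberTheory.LFunctions.WeilArchimedeanPositivityProofs
import HarnessLib

/-!
# `WindowStep` — negative lemma: consecutive rung families differ infinitely in BOTH directions

Refuter (crux disprover) record for the crux `stmt-RiemannHypothesis-14659`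
(`Summit.RiemannHypothesis.RiemannHypothesis.Theses.SpectralTrace.WindowStep`). This file closes
the series `Nested.lean` (no step by pure addition / pure deletion) and `FiniteMoves.lean` (no
step by finitely many moves) with their common generalisation:

* (toolkit, `ExpSumUniqueness.lean`) `multiset_eq_of_sum_weilMellin_eq₂`: exponential-sum
  uniqueness from window tests for two finite families of possibly different index types;
* `finite_and_multiset_eq_of_cofinite_matching` (**core**): let `γ : ι → ℝ` and
  `γ' : ι' → ℝ` both reproduce `W` on the Weil tests supported in `[-A, A]` (`A > 0`), and let
  `γ'` contain a copy of `γ` minus FINITELY many atoms `F` (an injection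
  `e : {i // i ∉ F} → ι'` with `γ' ∘ e = γ`). Then the atoms of `γ'` outside the copy are
  finitely many too, and they are EXACTLY the removed atoms as a multiset. Proof: the outside
  atoms pay, on every window test, what the removed atoms pay; against the modulated
  autocorrelation centred at a far outside atom `T` this is `≥ c > 0` on the left but
  `≤ |F|·(C_w/(1+dist²))²` on the right (`norm_weilMellin_le`, two integrations by parts), so the
  outside atoms are bounded in height, hence finite (local finiteness); then uniqueness.
* `hasSum_iff_of_cofinite_matching`: consequently `γ'` and `γ` have the same trace on EVERY
  function; `no_windowStep_by_cofinite_matching`: if the rung-`A` family is not a rung-`B`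
  family (`A ≤ B`), no family obtained from it by finitely many removals and ANY additions is;
* `infinite_unmatched_of_windowStep` / `infinite_unadded_of_windowStep`: along any partial
  matching of atoms between a rung-`A`-not-`B` family and a rung-`B` family, infinitely many OLD
  atoms are unmatched AND infinitely many NEW atoms are unmatched.

So for the step `n → n+1`: unless the rung-`n` family already serves rung `n+1`, the rung-`(n+1)`
family removes infinitely many of its atoms AND adds infinitely many new ones (and, by
`FiniteMoves.no_windowStep_below_height`, at unbounded heights).
-/

set_option linter.dupNamespace false

noncomputable section

open Complex Set Filter MeasureTheory
open scoped Real Topology ContDiff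

namespace Summit.RiemannHypothesis.RiemannHypothesis.Theorems.WindowStep.Negative

open Literature.NumberTheory.LFunctions
open Summit.RiemannHypothesis.RiemannHypothesis.Theses.SpectralTrace
open Summit.RiemannHypothesis.RiemannHypothesis.Theorems.WindowTraceArch.Negative

/-! ### Cofinite matchings between window families -/

/-- **The outside atoms pay what the removed atoms pay.** Let `γ, γ'` reproduce `W` on the
tests supported in `[-A, A]` and let `e : {i // i ∉ F} → ι'` be an injection with `γ' ∘ e = γ`.
Then on every such test the atoms of `γ'` outside `range e` sum to `Σ_{i∈F} ĝ(1/2 + iγ_i)`.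
[folklore] -/
theorem hasSum_compl_range_of_cofinite_matching {A : ℝ} {ι ι' : Type*} {γ : ι → ℝ}
    {γ' : ι' → ℝ} (F : Finset ι) {e : {i // i ∉ F} → ι'} (he : Function.Injective e)
    (hext : ∀ i, γ' (e i) = γ i)
    (hγ : ∀ g : ℝ → ℂ, IsWeilTest g → tsupport g ⊆ Icc (-A) A →
      HasSum (fun i => weilMellin g (1 / 2 + (γ i : ℂ) * I)) (weilFunctional g))
    (hγ' : ∀ g : ℝ → ℂ, IsWeilTest g → tsupport g ⊆ Icc (-A) A →
      HasSum (fun j => weilMellin g (1 / 2 + (γ' j : ℂ) * I)) (weilFunctional g))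
    {g : ℝ → ℂ} (hg : IsWeilTest g) (hgs : tsupport g ⊆ Icc (-A) A) :
    HasSum (fun j : ((Set.range e)ᶜ : Set ι') => weilMellin g (1 / 2 + (γ' j : ℂ) * I))
      (∑ i ∈ F, weilMellin g (1 / 2 + (γ i : ℂ) * I)) := by
  set u : ι → ℂ := fun i => weilMellin g (1 / 2 + (γ i : ℂ) * I) with hu
  set u' : ι' → ℂ := fun j => weilMellin g (1 / 2 + (γ' j : ℂ) * I) with hu'
  -- the copy of `γ` minus `F` inside `γ'` sums to `W g - Σ_F`
  have h1 : HasSum (fun x : {x // x ∉ F} => u x) (weilFunctional g - ∑ i ∈ F, u i) := by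
    rw [Finset.hasSum_compl_iff, sub_add_cancel]
    exact hγ g hg hgs
  have h2 : HasSum (u' ∘ e) (weilFunctional g - ∑ i ∈ F, u i) := by
    have e1 : u' ∘ e = fun x : {x // x ∉ F} => u x := by
      funext x
      simp only [Function.comp_apply, hu', hu, hext]
    rw [e1]
    exact h1
  have h3 : HasSum (u' ∘ (↑) : Set.range e → ℂ) (weilFunctional g - ∑ i ∈ F, u i) :=
    he.hasSum_range_iff.2 h2
  -- the rest of `γ'` sums to the difference
  have h4 := (h3.hasSum_compl_iff (a₂ := ∑ i ∈ F, u i)).2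
  rw [sub_add_cancel] at h4
  exact h4 (hγ' g hg hgs)

/-- **Core: a cofinite matching between window families has finite, matching defect.** Let
`γ : ι → ℝ` and `γ' : ι' → ℝ` reproduce `W` on the Weil tests supported in `[-A, A]` (`A > 0`)
and let `e : {i // i ∉ F} → ι'` (`F` finite) be an injection with `γ' ∘ e = γ`. Then the atoms
of `γ'` outside `range e` are finitely many and, as a multiset, equal to the removed atoms
`{γ_i : i ∈ F}`. [folklore] -/
theorem finite_and_multiset_eq_of_cofinite_matching {A : ℝ} (hA : 0 < A) {ι ι' : Type*}
    {γ : ι → ℝ} {γ' : ι' → ℝ} (F : Finset ι) {e : {i // i ∉ F} → ι'}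
    (he : Function.Injective e) (hext : ∀ i, γ' (e i) = γ i)
    (hγ : ∀ g : ℝ → ℂ, IsWeilTest g → tsupport g ⊆ Icc (-A) A →
      HasSum (fun i => weilMellin g (1 / 2 + (γ i : ℂ) * I)) (weilFunctional g))
    (hγ' : ∀ g : ℝ → ℂ, IsWeilTest g → tsupport g ⊆ Icc (-A) A →
      HasSum (fun j => weilMellin g (1 / 2 + (γ' j : ℂ) * I)) (weilFunctional g)) :
    ∃ hfin : ((Set.range e)ᶜ : Set ι').Finite,
      hfin.toFinset.val.map γ' = F.val.map γ := by
  classical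
  -- a narrow bump and its decay constant
  set δ : ℝ := min (A / 2) (1 / 2) with hδ_def
  have hδ : 0 < δ := lt_min (half_pos hA) one_half_pos
  have hδA : δ ≤ A / 2 := min_le_left _ _
  have hδ1 : δ ≤ 1 / 2 := min_le_right _ _
  obtain ⟨w, hw, hws, -, c, hc, hlow⟩ := exists_bump_lower hδ hδ1
  set Cw : ℝ := weilDecayConst w with hCw
  have hCw0 : 0 ≤ Cw := weilDecayConst_nonneg w
  -- heights of the removed atoms are bounded by `M`
  set M : ℝ := ∑ i ∈ F, |γ i| with hM
  have hM0 : 0 ≤ M := Finset.sum_nonneg fun i _ => abs_nonneg _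
  have hMi : ∀ i ∈ F, |γ i| ≤ M := fun i hi =>
    Finset.single_le_sum (fun j _ => abs_nonneg (γ j)) hi
  -- the height bound `R`
  set K : ℝ := F.card * Cw ^ 2 / c with hK
  have hK0 : 0 ≤ K := by positivity
  set R : ℝ := M + K + 1 with hR
  -- (1) every outside atom has height `≤ R`
  have hbound : ∀ j : ι', j ∉ Set.range e → |γ' j| ≤ R := by
    intro j₀ hj₀
    by_contra hfar
    rw [not_le] at hfar
    set T : ℝ := γ' j₀ with hT
    set wT : ℝ → ℂ := fun t => cexp (-((T * t : ℝ) : ℂ) * I) * w t with hwT_def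
    have hwT : IsWeilTest wT := isWeilTest_modulate hw T
    have hwTs : tsupport wT ⊆ Icc (-(A / 2)) (A / 2) :=
      ((tsupport_modulate_subset w T).trans hws).trans (Icc_subset_Icc (by linarith) hδA)
    set k : ℝ → ℂ := weilConv wT (weilReflect wT) with hk_def
    have hk : IsWeilTest k := hwT.weilConv hwT.weilReflect
    have hks : tsupport k ⊆ Icc (-A) A :=
      (tsupport_weilConv_weilReflect_subset hwT.2 hwTs).trans
        (Icc_subset_Icc (by linarith) (by linarith))
    have hS := hasSum_compl_range_of_cofinite_matching F he hext hγ hγ' hk hks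
    have hreal : ∀ x : ℝ, weilMellin k (1 / 2 + (x : ℂ) * I) =
        ((‖weilMellin w (1 / 2 + ((x - T : ℝ) : ℂ) * I)‖ ^ 2 : ℝ) : ℂ) := fun x => by
      rw [weilMellin_weilConv_weilReflect_half hwT x, weilMellin_modulate w T x]
    -- real form of the identity
    have hR' : HasSum (fun j : ((Set.range e)ᶜ : Set ι') =>
        ‖weilMellin w (1 / 2 + ((γ' j - T : ℝ) : ℂ) * I)‖ ^ 2)
        (∑ i ∈ F, ‖weilMellin w (1 / 2 + ((γ i - T : ℝ) : ℂ) * I)‖ ^ 2) := by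
      have h3 := hS.mapL Complex.reCLM
      simpa only [hreal, Complex.reCLM_apply, Complex.ofReal_re, map_sum] using h3
    -- the outside atom `j₀` alone costs `≥ c`
    have hlow0 : c ≤ ∑ i ∈ F, ‖weilMellin w (1 / 2 + ((γ i - T : ℝ) : ℂ) * I)‖ ^ 2 := by
      have h5 := le_hasSum hR' ⟨j₀, hj₀⟩ fun j _ => by positivity
      have h6 : c ≤ ‖weilMellin w (1 / 2 + ((γ' j₀ - T : ℝ) : ℂ) * I)‖ ^ 2 := by
        refine hlow (γ' j₀ - T) ?_
        rw [hT, sub_self, abs_zero]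
        exact zero_le_one
      exact h6.trans h5
    -- but the removed atoms are far from `T`: each costs `≤ (Cw / (1 + (K+1)^2))^2 ≤ Cw^2/(K+1)`
    have hterm : ∀ i ∈ F,
        ‖weilMellin w (1 / 2 + ((γ i - T : ℝ) : ℂ) * I)‖ ^ 2 ≤ Cw ^ 2 / (K + 1) := by
      intro i hi
      have hdec := norm_weilMellin_le hw (s := 1 / 2 + ((γ i - T : ℝ) : ℂ) * I)
        (by simp) (by norm_num)
      have him : (1 / 2 + ((γ i - T : ℝ) : ℂ) * I).im = γ i - T := by simp
      rw [him] at hdec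
      have hdist : K + 1 ≤ |γ i - T| := by
        have h7 : |T| - |γ i| ≤ |γ i - T| := by
          have := abs_sub_abs_le_abs_sub T (γ i)
          rwa [abs_sub_comm] at this
        have h8 := hMi i hi
        rw [hT] at hfar h7 ⊢
        linarith
      have hden : K + 1 ≤ 1 + (γ i - T) ^ 2 := by
        have h9 : (K + 1) ≤ (K + 1) ^ 2 := by nlinarith
        have h10 : (K + 1) ^ 2 ≤ |γ i - T| ^ 2 := by
          exact pow_le_pow_left₀ (by linarith) hdist 2
        rw [sq_abs] at h10
        linarith
      have hpos1 : 0 < K + 1 := by linarith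
      have hpos2 : 0 < 1 + (γ i - T) ^ 2 := by positivity
      have hn0 : 0 ≤ ‖weilMellin w (1 / 2 + ((γ i - T : ℝ) : ℂ) * I)‖ := norm_nonneg _
      calc ‖weilMellin w (1 / 2 + ((γ i - T : ℝ) : ℂ) * I)‖ ^ 2
          ≤ (Cw / (1 + (γ i - T) ^ 2)) ^ 2 := pow_le_pow_left₀ hn0 hdec 2
        _ = Cw ^ 2 / (1 + (γ i - T) ^ 2) ^ 2 := by rw [div_pow]
        _ ≤ Cw ^ 2 / (1 + (γ i - T) ^ 2) := by
            apply div_le_div_of_nonneg_left (by positivity) hpos2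
            nlinarith
        _ ≤ Cw ^ 2 / (K + 1) := div_le_div_of_nonneg_left (by positivity) hpos1 hden
    have hsum : ∑ i ∈ F, ‖weilMellin w (1 / 2 + ((γ i - T : ℝ) : ℂ) * I)‖ ^ 2 ≤
        F.card * (Cw ^ 2 / (K + 1)) := by
      have := Finset.sum_le_sum hterm
      rwa [Finset.sum_const, nsmul_eq_mul] at this
    -- `|F| Cw² / (K+1) < c` by the choice `K = |F| Cw² / c`
    have hlt : (F.card : ℝ) * (Cw ^ 2 / (K + 1)) < c := by
      have hpos1 : 0 < K + 1 := by linarith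
      rw [← mul_div_assoc, div_lt_iff₀ hpos1]
      have : (F.card : ℝ) * Cw ^ 2 = K * c := by
        rw [hK]; field_simp
      rw [this]
      nlinarith
    linarith
  -- (2) hence the outside atoms form a finite set (local finiteness of `γ'`)
  have hfin : ((Set.range e)ᶜ : Set ι').Finite :=
    (finite_abs_le_of_windowTrace hA hγ' R).subset fun j hj => hbound j hj
  refine ⟨hfin, ?_⟩
  -- (3) finite identity on every test, then uniqueness
  refine multiset_eq_of_sum_weilMellin_eq₂ hA hfin.toFinset F γ' γ fun g hg hgs => ?_
  have hS := hasSum_compl_range_of_cofinite_matching F he hext hγ hγ' hg hgs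
  have hF' := Finset.hasSum hfin.toFinset (fun j => weilMellin g (1 / 2 + (γ' j : ℂ) * I))
  have hset : (↑hfin.toFinset : Set ι') = (Set.range e)ᶜ := hfin.coe_toFinset
  rw [hset] at hF'
  exact hF'.unique hS

/-- **Consequence: same trace on every function.** Under a cofinite matching, the two window
families give the same sum, with the same value, on EVERY `g` (any window or none). [folklore] -/
theorem hasSum_iff_of_cofinite_matching {A : ℝ} (hA : 0 < A) {ι ι' : Type*}
    {γ : ι → ℝ} {γ' : ι' → ℝ} (F : Finset ι) {e : {i // i ∉ F} → ι'}
    (he : Function.Injective e) (hext : ∀ i, γ' (e i) = γ i)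
    (hγ : ∀ g : ℝ → ℂ, IsWeilTest g → tsupport g ⊆ Icc (-A) A →
      HasSum (fun i => weilMellin g (1 / 2 + (γ i : ℂ) * I)) (weilFunctional g))
    (hγ' : ∀ g : ℝ → ℂ, IsWeilTest g → tsupport g ⊆ Icc (-A) A →
      HasSum (fun j => weilMellin g (1 / 2 + (γ' j : ℂ) * I)) (weilFunctional g))
    (g : ℝ → ℂ) (s : ℂ) :
    HasSum (fun j => weilMellin g (1 / 2 + (γ' j : ℂ) * I)) s ↔
      HasSum (fun i => weilMellin g (1 / 2 + (γ i : ℂ) * I)) s := by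
  classical
  obtain ⟨hfin, hM⟩ := finite_and_multiset_eq_of_cofinite_matching hA F he hext hγ hγ'
  set u : ι → ℂ := fun i => weilMellin g (1 / 2 + (γ i : ℂ) * I) with hu
  set u' : ι' → ℂ := fun j => weilMellin g (1 / 2 + (γ' j : ℂ) * I) with hu'
  -- the two finite defects agree on `g`
  have hdef : ∑ j ∈ hfin.toFinset, u' j = ∑ i ∈ F, u i := by
    simp only [hu, hu']
    rw [Finset.sum_eq_multiset_sum, Finset.sum_eq_multiset_sum]
    have e1 : Multiset.map (fun j => weilMellin g (1 / 2 + (γ' j : ℂ) * I)) hfin.toFinset.val =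
        Multiset.map (fun x : ℝ => weilMellin g (1 / 2 + (x : ℂ) * I))
          (Multiset.map γ' hfin.toFinset.val) := by rw [Multiset.map_map]; rfl
    have e2 : Multiset.map (fun i => weilMellin g (1 / 2 + (γ i : ℂ) * I)) F.val =
        Multiset.map (fun x : ℝ => weilMellin g (1 / 2 + (x : ℂ) * I))
          (Multiset.map γ F.val) := by rw [Multiset.map_map]; rfl
    rw [e1, e2, hM]
  -- outside part of `γ'` (finite) and the copy
  have hout : HasSum (u' ∘ (↑) : ((Set.range e)ᶜ : Set ι') → ℂ) (∑ i ∈ F, u i) := by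
    have hF' := Finset.hasSum hfin.toFinset u'
    rw [hfin.coe_toFinset, hdef] at hF'
    exact hF'
  have hcopy : ∀ t : ℂ, HasSum (u' ∘ (↑) : Set.range e → ℂ) t ↔
      HasSum (fun x : {x // x ∉ F} => u x) t := by
    intro t
    have h5 : HasSum (fun x : Set.range e => u' x) t ↔ HasSum (u' ∘ e) t := he.hasSum_range_iff
    have e1 : u' ∘ e = fun x : {x // x ∉ F} => u x := by
      funext x
      simp only [Function.comp_apply, hu', hu, hext]
    rw [e1] at h5
    exact h5
  constructor
  · intro hs
    -- `γ'`-sum `s` ⇒ copy sums to `s - Σ_F u` ⇒ `γ` sums to `s`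
    have h1 : HasSum (u' ∘ (↑) : Set.range e → ℂ) (s - ∑ i ∈ F, u i) := by
      have hsum : Summable (u' ∘ (↑) : Set.range e → ℂ) := hs.summable.subtype _
      obtain ⟨t, ht⟩ := hsum
      have h2 := (ht.add_compl hout).unique hs
      have h3 : t = s - ∑ i ∈ F, u i := by rw [← h2]; ring
      rwa [h3] at ht
    have h4 := (hcopy _).1 h1
    rw [Finset.hasSum_compl_iff, sub_add_cancel] at h4
    exact h4
  · intro hs
    have h1 : HasSum (fun x : {x // x ∉ F} => u x) (s - ∑ i ∈ F, u i) := by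
      rw [Finset.hasSum_compl_iff, sub_add_cancel]
      exact hs
    have h2 := ((hcopy _).2 h1).add_compl hout
    rwa [sub_add_cancel] at h2

/-- **Crux form: no step by finitely many removals plus any additions.** Let `γ` reproduce `W`
on the tests supported in `[-A, A]` but not on those supported in `[-B, B]` (`0 < A ≤ B`; for
the step `A = log n`, `B = log (n+1)`). Then no family `γ'` containing a copy of `γ` minus
finitely many atoms reproduces `W` on `[-B, B]`. [folklore] -/
theorem no_windowStep_by_cofinite_matching {A B : ℝ} (hA : 0 < A) (hAB : A ≤ B) {ι ι' : Type*}
    {γ : ι → ℝ} {γ' : ι' → ℝ} (F : Finset ι) {e : {i // i ∉ F} → ι'}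
    (he : Function.Injective e) (hext : ∀ i, γ' (e i) = γ i)
    (hAγ : ∀ g : ℝ → ℂ, IsWeilTest g → tsupport g ⊆ Icc (-A) A →
      HasSum (fun i => weilMellin g (1 / 2 + (γ i : ℂ) * I)) (weilFunctional g))
    (hBγ : ¬ ∀ g : ℝ → ℂ, IsWeilTest g → tsupport g ⊆ Icc (-B) B →
      HasSum (fun i => weilMellin g (1 / 2 + (γ i : ℂ) * I)) (weilFunctional g)) :
    ¬ ∀ g : ℝ → ℂ, IsWeilTest g → tsupport g ⊆ Icc (-B) B →
      HasSum (fun j => weilMellin g (1 / 2 + (γ' j : ℂ) * I)) (weilFunctional g) := by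
  intro hBγ'
  have hAγ' : ∀ g : ℝ → ℂ, IsWeilTest g → tsupport g ⊆ Icc (-A) A →
      HasSum (fun j => weilMellin g (1 / 2 + (γ' j : ℂ) * I)) (weilFunctional g) :=
    fun g hg hgs => hBγ' g hg (hgs.trans (Icc_subset_Icc (neg_le_neg hAB) hAB))
  exact hBγ fun g hg hgs =>
    (hasSum_iff_of_cofinite_matching hA F he hext hAγ hAγ' g (weilFunctional g)).1 (hBγ' g hg hgs)

/-- **Both ways, quantitatively: infinitely many removals.** If `γ` (rung `A`, not rung `B`)
and `γ'` (rung `B`, `A ≤ B`) are matched along an injection `e : S → ι'` from a set of indices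
`S ⊆ ι` (`γ' ∘ e = γ` on `S`), then the unmatched indices `Sᶜ` are INFINITE. (The additions
`(range e)ᶜ` are then infinite as well whenever `Sᶜ` is finite — vacuously — and by symmetry of
the roles when `γ'` minus finitely many atoms embeds back into `γ`.) [folklore] -/
theorem infinite_unmatched_of_windowStep {A B : ℝ} (hA : 0 < A) (hAB : A ≤ B) {ι ι' : Type*}
    {γ : ι → ℝ} {γ' : ι' → ℝ} (S : Set ι) {e : S → ι'} (he : Function.Injective e)
    (hext : ∀ i : S, γ' (e i) = γ i)
    (hAγ : ∀ g : ℝ → ℂ, IsWeilTest g → tsupport g ⊆ Icc (-A) A →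
      HasSum (fun i => weilMellin g (1 / 2 + (γ i : ℂ) * I)) (weilFunctional g))
    (hBγ : ¬ ∀ g : ℝ → ℂ, IsWeilTest g → tsupport g ⊆ Icc (-B) B →
      HasSum (fun i => weilMellin g (1 / 2 + (γ i : ℂ) * I)) (weilFunctional g))
    (hBγ' : ∀ g : ℝ → ℂ, IsWeilTest g → tsupport g ⊆ Icc (-B) B →
      HasSum (fun j => weilMellin g (1 / 2 + (γ' j : ℂ) * I)) (weilFunctional g)) :
    Sᶜ.Infinite := by
  classical
  intro hfin
  -- re-index the matching by the complement of the finset `F = Sᶜ`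
  set F : Finset ι := hfin.toFinset with hF
  have hmem : ∀ i : ι, i ∉ F ↔ i ∈ S := fun i => by
    rw [hF, Set.Finite.mem_toFinset, Set.mem_compl_iff, not_not]
  set e' : {i // i ∉ F} → ι' := fun x => e ⟨x.1, (hmem x.1).1 x.2⟩ with he'
  have he'i : Function.Injective e' := by
    intro x y hxy
    have := he hxy
    apply Subtype.ext
    simpa using congrArg Subtype.val this
  have hext' : ∀ x, γ' (e' x) = γ x := fun x => hext ⟨x.1, (hmem x.1).1 x.2⟩
  exact no_windowStep_by_cofinite_matching hA hAB F he'i hext' hAγ hBγ hBγ'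


/-- **Both ways, the other direction: infinitely many additions.** If `γ` (rung `A`, not rung
`B`) and `γ'` (rung `B`, `A ≤ B`) are matched along an injection `e' : S' → ι` from a set of NEW
indices `S' ⊆ ι'` into the old family (`γ ∘ e' = γ'` on `S'`), then the unmatched new indices
`S'ᶜ` are INFINITE: infinitely many atoms of the rung-`(n+1)` family are not atoms of the rung-`n`
family. (Same engine, roles swapped: the matching theorem only uses rung `A` on both sides.)
[folklore] -/
theorem infinite_unadded_of_windowStep {A B : ℝ} (hA : 0 < A) (hAB : A ≤ B) {ι ι' : Type*}
    {γ : ι → ℝ} {γ' : ι' → ℝ} (S' : Set ι') {e' : S' → ι} (he' : Function.Injective e')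
    (hext' : ∀ j : S', γ (e' j) = γ' j)
    (hAγ : ∀ g : ℝ → ℂ, IsWeilTest g → tsupport g ⊆ Icc (-A) A →
      HasSum (fun i => weilMellin g (1 / 2 + (γ i : ℂ) * I)) (weilFunctional g))
    (hBγ : ¬ ∀ g : ℝ → ℂ, IsWeilTest g → tsupport g ⊆ Icc (-B) B →
      HasSum (fun i => weilMellin g (1 / 2 + (γ i : ℂ) * I)) (weilFunctional g))
    (hBγ' : ∀ g : ℝ → ℂ, IsWeilTest g → tsupport g ⊆ Icc (-B) B →
      HasSum (fun j => weilMellin g (1 / 2 + (γ' j : ℂ) * I)) (weilFunctional g)) :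
    S'ᶜ.Infinite := by
  classical
  intro hfin
  set F' : Finset ι' := hfin.toFinset with hF'
  have hmem : ∀ j : ι', j ∉ F' ↔ j ∈ S' := fun j => by
    rw [hF', Set.Finite.mem_toFinset, Set.mem_compl_iff, not_not]
  set e'' : {j // j ∉ F'} → ι := fun x => e' ⟨x.1, (hmem x.1).1 x.2⟩ with he''
  have he''i : Function.Injective e'' := by
    intro x y hxy
    have := he' hxy
    apply Subtype.ext
    simpa using congrArg Subtype.val this
  have hext'' : ∀ x, γ (e'' x) = γ' x := fun x => hext' ⟨x.1, (hmem x.1).1 x.2⟩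
  have hAγ' : ∀ g : ℝ → ℂ, IsWeilTest g → tsupport g ⊆ Icc (-A) A →
      HasSum (fun j => weilMellin g (1 / 2 + (γ' j : ℂ) * I)) (weilFunctional g) :=
    fun g hg hgs => hBγ' g hg (hgs.trans (Icc_subset_Icc (neg_le_neg hAB) hAB))
  exact hBγ fun g hg hgs =>
    (hasSum_iff_of_cofinite_matching hA F' he''i hext'' hAγ' hAγ g (weilFunctional g)).2
      (hBγ' g hg hgs)

end Summit.RiemannHypothesis.RiemannHypothesis.Theorems.WindowStep.Negative

end
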